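import Literature.NumberTheory.EllipticCurves.BurungaleTian2026.EtaSignedMainConjectureTensorQ
import Summits.BirchSwinnertonDyer.Rank1Residual.Additive.CyclotomicTowerSignedSelmer
import Summits.BirchSwinnertonDyer.Rank1Residual.Additive.QuadraticBranchPlusLFunctionUnique
import HarnessLib

/-!
# Route `InertBadSignedBranches` (rung K8), item stmt-BirchSwinnertonDyer-19501 `PlusMCEtaK`:
# the item's statement WITH THE `μ`-PART REMOVED — Kobayashi's even `η`-main conjecture for a CM
# curve UP TO POWERS OF `p` — is a THEOREM from print (helper `--supports 19501`; cell bsd-cm,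
# READY-TO-FILE by a prover hand; drafted by the typer seat bsd-cm-k8i-ty g6)

HONEST FRAMING (cell bsd-cm): BSD is NOT proved by any of this; the programme assembles the rank-`≤ 1`
formula from PUBLISHED theorems and TYPES the remainder; a closed item closes a rung leaf, never the
summit. THIS FILE books nothing and moves no label: ONE theorem, no definition, no new fact, no
`sorry`. It does NOT close 19501 (whose conclusion is the full equality `D.charIdeal = (Lp)`,
`μ`-part included); it proves the item's `⊗ℚ`-shadow on the route's OWN objects
(`Additive.EtaSignedSelmerDualData`, `Additive.IsQuadraticBranchPlusLFunction`) from the Literature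
file `BurungaleTian2026/EtaSignedMainConjectureTensorQ.lean` (Burungale–Tian, Ann. of Math. 203
(2026) Thm. 2.6 read on the `η`-ends of Kobayashi 2003 §5 / Prop. 7.1 ii) / proof of Thm. 7.4 —
ONE composed-citation named fact, displayed as `h26`) and Kobayashi's Thm. 2.2 at `η` (`h22`), via
the field-for-field (`rfl`) transport of the dual datum to its Literature copy
`Kobayashi2003.EtaSignedSelmerDualData` (the same anonymous-constructor term as
`PrintReadingsOfLiterature.toLiterature`, INLINED here so that this helper imports NO `Theses.*`
module, directly or transitively — standing build rule of 2026-08-26: only item closers import the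
route file; this file's import closure is `Rank1Residual.Additive.*` + `Literature.*` only) and the
uniqueness of the ideal `(L_p⁺(V, η, X))` (`Additive.IsQuadraticBranchPlusLFunction.span_singleton_eq`).
Filed by the prover hand bsd-cm-k8i-c42 g9 (statements = the typer's draft verbatim; proofs re-routed
around the `Theses` cone).

WHAT IT SAYS: for `p` odd, `η` the quadratic character of `Gal(ℚ(μ_p)/ℚ)`, `V/ℚ` CM, globally
minimal, good at `p` with `a_p = 0`, every `Lp` with Kobayashi's interpolation property of
`L_p⁺(V, η, X)` and every Pontryagin-dual datum `D` of `Sel⁺(V/K_∞)^η`: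
`(p^b)·Char(X(D)) = (p^a)·(Lp)` for some `a b : ℕ` — the characteristic power series of
`X⁺(V/ℚ(μ_{p^∞}))^η` and `L_p⁺(V, η, X)` have the same distinguished polynomial (same `λ`-invariant,
same zeroes) and differ at most by `p^{a−b}` times a unit. What remains of 19501 after this is
EXACTLY the `μ`-equality (Burungale–Tian Rem. 2.7 «integral versions … near future»; cell memo N26
§3 derives it on paper). Suggested to the planner: split 19501 into this shape (`PlusMCEtaKUpToMu`,
closable by this file's theorem) and the `μ`-part.

References: [BurungaleTian2026] Thm. 2.6, Rem. 2.7 (p. 5); [Kobayashi2003] §4 (p. 8), §5 (p. 10),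
Prop. 7.1 ii) (p. 12), Thm. 7.4 and its proof (p. 13), Thm. 2.2 (p. 5), Thm. 3.2 (p. 7).
-/

set_option linter.dupNamespace false

noncomputable section

open scoped Classical

open CongruenceSubgroup WeierstrassCurve Field Literature.NumberTheory.EllipticCurves
  Literature.NumberTheory.EllipticCurves.ModularForms Literature.NumberTheory.GaloisRepresentations
  ZpExtension Summit.BirchSwinnertonDyer.Rank1Residual

namespace Summit.BirchSwinnertonDyer.BirchSwinnertonDyer.Theorems.PlusMCEtaKUpToMu

/-- **Item 19501 `PlusMCEtaK` up to powers of `p`, from print.** Frame of `PlusMCEtaK` (binder for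
binder, with `V.HasCM` — the route's `V` is the CM twin) and conclusion
`∃ a b, (p^b)·D.charIdeal = (p^a)·(Lp)` in place of `D.charIdeal = (Lp)`: from the Literature fact
`BurungaleTian2026.thm26_etaKatoSequences_charIdeal_upToP_of_cm` (`h26`: Burungale–Tian 2026 Thm. 2.6
∘ Kobayashi 2003 §5 / 7.1 ii) / proof of 7.4, composed citation) and
`Kobayashi2003.thm22_etaSignedSelmerDual_finite_torsion` (`h22`), through the `rfl` transport of the
dual datum and the uniqueness of `(L_p⁺(V, η, X))`. Helper `--supports 19501`; closes nothing.
[cite: BurungaleTian2026, Thm. 2.6 (p. 5)] [cite: Kobayashi2003, proof of Thm. 7.4 (p. 13), Prop. 7.1 ii) (p. 12), Thm. 2.2 (p. 5)] -/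
theorem plusMCEtaK_upToP_of_burungaleTian
    (h26 : BurungaleTian2026.thm26_etaKatoSequences_charIdeal_upToP_of_cm)
    (h22 : Kobayashi2003.thm22_etaSignedSelmerDual_finite_torsion)
    (p : ℕ) [Fact p.Prime] (hp : p ≠ 2) (K₀ : Type) [Field K₀] [NumberField K₀]
    [IsCyclotomicExtension {p} ℚ K₀] [(galRange (K := ℚ) K₀).Normal]
    (η : absoluteGaloisGroup ℚ →* ℤˣ) (hη : ∀ σ ∈ galRange (K := ℚ) K₀, η σ = 1) (hη1 : η ≠ 1)
    (V : WeierstrassCurve ℚ) [V.IsElliptic] [V.IsGloballyMinimal] {N : ℕ} [NeZero N]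
    {f : CuspForm (Gamma0 N) 2} (hCM : V.HasCM) (hgood : V.HasGoodReductionAtPrime p)
    (hap : V.frobeniusTrace p = 0) (hf : IsNewformOf V f) (ϖ : ℚ)
    (hϖ : if Even (p / 2) then (ϖ : ℝ) * V.realPeriodRat = plusPeriod f
      else (ϖ : ℝ) * V.imaginaryPeriodRat = minusPeriod f)
    (κ : ZpExtension ℚ p) (γ : absoluteGaloisGroup ℚ) (hκ : κ.IsCyclotomic) (hγ : κ.IsTopGenerator γ)
    (hγK : γ ∈ galRange (K := ℚ) K₀) (hvar : IsCyclotomicVariable p γ)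
    (Lp : IwasawaAlgebra p) (hLp : Additive.IsQuadraticBranchPlusLFunction f p ϖ Lp)
    (D : Additive.EtaSignedSelmerDualData V κ K₀ ℚ_[p] η γ 1) :
    ∃ a b : ℕ, Ideal.span {(p : IwasawaAlgebra p) ^ b} * D.charIdeal =
      Ideal.span {(p : IwasawaAlgebra p) ^ a} * Ideal.span {Lp} := by
  -- the Literature copy of the pinning predicate IS the Summits original (`Iff.rfl`)
  have hiff : ∀ L : IwasawaAlgebra p, Kobayashi2003.IsQuadraticBranchPlusLFunction f p ϖ L ↔
      Additive.IsQuadraticBranchPlusLFunction f p ϖ L := fun _ => Iff.rfl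
  have huniq : ∀ L₁ L₂ : IwasawaAlgebra p,
      Kobayashi2003.IsQuadraticBranchPlusLFunction f p ϖ L₁ →
      Kobayashi2003.IsQuadraticBranchPlusLFunction f p ϖ L₂ →
      Ideal.span {L₁} = Ideal.span {L₂} := fun L₁ L₂ h₁ h₂ =>
    Additive.IsQuadraticBranchPlusLFunction.span_singleton_eq hp ((hiff L₁).mp h₁) ((hiff L₂).mp h₂)
  -- the field-for-field transport of the dual datum (same module `D.X`, same `charIdeal` by `rfl`)
  let D' : Kobayashi2003.EtaSignedSelmerDualData V κ K₀ ℚ_[p] η γ 1 :=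
    ⟨D.X, D.conj_mem, D.toDual, D.bijective, D.toDual_T_smul, D.toDual_C_smul⟩
  have hD' : D'.charIdeal = D.charIdeal := rfl
  obtain ⟨a, b, hab⟩ := BurungaleTian2026.evenEtaCharIdeal_eq_upToP_of_cm_of_unique h26 h22 K₀ η
    hη hη1 V hp hCM hgood hap hf ϖ hϖ huniq κ γ hκ hγ hγK hvar Lp ((hiff Lp).mpr hLp) D'
  exact ⟨a, b, by rwa [hD'] at hab⟩

/-- **Item 19501 ⟺ its `μ`-part (kernel glue for a by-name split).** Same frame: the conclusion of
`PlusMCEtaK` verbatim, `D.charIdeal = (Lp)`, holds IF AND ONLY IF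
`μ(X(D)) = μ(Λ/(Lp))` (`muInvariant`), by the Literature file's §4
`BurungaleTian2026.evenEtaCharIdeal_eq_iff_muInvariant_eq_of_cm` transported along the field-for-field
(`rfl`) copy of the datum (inlined `toLiterature`; no `Theses` import).
So a split of 19501 into the `μ`-free twin (closed by `plusMCEtaK_upToP_of_burungaleTian`) and the
`μ`-statement has its glue PROVED here. Helper `--supports 19501`; closes nothing.
[cite: BurungaleTian2026, Thm. 2.6 and Rem. 2.7 (p. 5)] [cite: Kobayashi2003, §4 (p. 8), proof of Thm. 7.4 (p. 13)]
[cite: Washington1997, §13.2] -/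
theorem plusMCEtaK_iff_muInvariant_eq_of_burungaleTian
    (h26 : BurungaleTian2026.thm26_etaKatoSequences_charIdeal_upToP_of_cm)
    (h22 : Kobayashi2003.thm22_etaSignedSelmerDual_finite_torsion)
    (p : ℕ) [Fact p.Prime] (hp : p ≠ 2) (K₀ : Type) [Field K₀] [NumberField K₀]
    [IsCyclotomicExtension {p} ℚ K₀] [(galRange (K := ℚ) K₀).Normal]
    (η : absoluteGaloisGroup ℚ →* ℤˣ) (hη : ∀ σ ∈ galRange (K := ℚ) K₀, η σ = 1) (hη1 : η ≠ 1)
    (V : WeierstrassCurve ℚ) [V.IsElliptic] [V.IsGloballyMinimal] {N : ℕ} [NeZero N]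
    {f : CuspForm (Gamma0 N) 2} (hCM : V.HasCM) (hgood : V.HasGoodReductionAtPrime p)
    (hap : V.frobeniusTrace p = 0) (hf : IsNewformOf V f) (ϖ : ℚ)
    (hϖ : if Even (p / 2) then (ϖ : ℝ) * V.realPeriodRat = plusPeriod f
      else (ϖ : ℝ) * V.imaginaryPeriodRat = minusPeriod f)
    (κ : ZpExtension ℚ p) (γ : absoluteGaloisGroup ℚ) (hκ : κ.IsCyclotomic) (hγ : κ.IsTopGenerator γ)
    (hγK : γ ∈ galRange (K := ℚ) K₀) (hvar : IsCyclotomicVariable p γ)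
    (Lp : IwasawaAlgebra p) (hLp : Additive.IsQuadraticBranchPlusLFunction f p ϖ Lp)
    (D : Additive.EtaSignedSelmerDualData V κ K₀ ℚ_[p] η γ 1) :
    D.charIdeal = Ideal.span {Lp} ↔
      muInvariant p D.X = muInvariant p (IwasawaAlgebra p ⧸ Ideal.span {Lp}) := by
  have hiff : ∀ L : IwasawaAlgebra p, Kobayashi2003.IsQuadraticBranchPlusLFunction f p ϖ L ↔
      Additive.IsQuadraticBranchPlusLFunction f p ϖ L := fun _ => Iff.rfl
  have huniq : ∀ L₁ L₂ : IwasawaAlgebra p,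
      Kobayashi2003.IsQuadraticBranchPlusLFunction f p ϖ L₁ →
      Kobayashi2003.IsQuadraticBranchPlusLFunction f p ϖ L₂ →
      Ideal.span {L₁} = Ideal.span {L₂} := fun L₁ L₂ h₁ h₂ =>
    Additive.IsQuadraticBranchPlusLFunction.span_singleton_eq hp ((hiff L₁).mp h₁) ((hiff L₂).mp h₂)
  let D' : Kobayashi2003.EtaSignedSelmerDualData V κ K₀ ℚ_[p] η γ 1 :=
    ⟨D.X, D.conj_mem, D.toDual, D.bijective, D.toDual_T_smul, D.toDual_C_smul⟩
  have hD' : D'.charIdeal = D.charIdeal := rfl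
  have h := BurungaleTian2026.evenEtaCharIdeal_eq_iff_muInvariant_eq_of_cm h26 h22 K₀ η hη hη1 V
    hp hCM hgood hap hf ϖ hϖ huniq κ γ hκ hγ hγK hvar Lp ((hiff Lp).mpr hLp) D'
  rw [hD'] at h
  -- `D'.X` is `D.X` with the same instances (field-for-field copy), so `h` is the goal up to `rfl`
  exact h

end Summit.BirchSwinnertonDyer.BirchSwinnertonDyer.Theorems.PlusMCEtaKUpToMu

end
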